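import Summits.CriticalPhenomena.CardyFormulaZ2.Theorems.CardyComplexConeEdgePrecompactUFRSSlippedReturnBallLastExcursion
import Summits.CriticalPhenomena.CardyFormulaZ2.Theorems.CardyComplexConeEdgePrecompactUFRSArmDominationFace

set_option linter.unusedVariables false

/-!
# Slipped return, BALL-EXIT pair: the certificate (three long strands at the last split)
(line `qkz-strip-boundary-arm` of crux `CardyComplexCone.EdgePrecompact`, stmt-CriticalPhenomena-11387;
the ball-exit half (R1) of the residual `ufrs_slippedReturnCase_certJ` of the SPLIT branch of the
UFRS arm domination, registered as `ufrs_slippedReturn_ballExit_certJ`)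

Setting (hypotheses of `ufrs_slippedReturnCase_certJ` with the pair hypothesis specialised to the
BALL-EXIT pair `a = a'`, `medialPoint E.δ (cSrc a) ∈ B(E.δ v, ρ)`): the first stretch
`S₀ = O₀ a [0, n]` of the completed dynamics `β₀` of `E` and the second stretch
`O₁ a [0, k + T]` of the completed dynamics `β₁` of the translate `shiftData E w` leave the
`2ρ`-deep ball at the same corner `a`, re-enter it at the same corner `O₀ a n = O₁ a (k + T)`, keep
all intermediate target midpoints off the ball, and have different turning sums
(synchronisation `hsum` up to the split corner `O₀ a m = O₁ a k` plus the mismatch clause `hmis`).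

Proof of the certificate `ω ∈ ufrsCert E w z (4η) (ρ/2)` at a collar point `z` (FAR branch, or
the escape `ρ/2 < 256 · 4η`):
1. (`twoArc_dartWnd_ne_SR`) at a face `F` next to the first coded dart the winding weights
   `a_i = dartWnd` of the darts of `S₀` and `b_j` of the second stretch have different totals,
   `Δ = ∑ a - ∑ b ≠ 0`; common corners carry equal weights.
2. (`exists_lastBad_common_SR`) let `s` be the LAST common time (`O₁ a s = O₀ a σ`) whose offset
   `∑_{i<σ} a - ∑_{j<s} b` is not `Δ`; every later common time has offset `Δ`. Hence the two
   dynamics SPLIT at `O₀ a σ` (a common step keeps the offset), so the target edge of `O₀ a σ` is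
   a discrepancy edge and the vertex `X` of `O₀ a σ` lies in the `3η`-collar
   (`collarAgreement`); it is far from `a`, from `O₀ a n` and from `F` (all at the deep ball).
3. Three strands at `z = E.δ X`: `O₀ a [h', σ]` and `O₀ a [σ + 1, i']` (`h'` the last index
   before `σ`, `i'` the first index after `σ`, at distance `≥ ρ/4 + 4 E.δ` from `z`) and the
   second stretch after the split, `O₁ a [s + 1, g]` (`g` the first later time at distance
   `≥ ρ/4 + 2 E.δ`). They are pairwise corner-disjoint: a coincidence `O₁ a j = O₀ a i` with
   `s < j ≤ g`, `h' ≤ i ≤ i'` is impossible — `i = σ` contradicts injectivity, a far `i`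
   contradicts the minimality of `g`, and a near `i ≠ σ` is a LATER COMMON TIME whose offset is
   `Δ`, while by the confinement principle `twoArc_offset_eq_of_confined_SR` (the pieces
   `O₀ a [σ ↔ i]`, `O₁ a [s, j]` stay within `ρ/4 + 5 E.δ` of `z`, the face `F` is at distance
   `> ρ - 3η - E.δ`) its offset equals the offset at `s`, which is not `Δ`.
4. `mem_ufrsCert_of_three_far_W3H`.
This covers all sub-cases of the strand extraction at once (no case analysis on the free arc).

References: S. Smirnov, C. R. Acad. Sci. Paris 333 (2001), §2; H. Hopf, Compositio Math. 2 (1935);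
P. Nolin, Electron. J. Probab. 13 (2008), §4 (arm events in annuli).
-/

namespace Summit.CriticalPhenomena.CardyFormulaZ2.Cruxes.EdgePrecompact.QkzStripBoundaryArm

open MeasureTheory Filter Set Metric
open scoped Topology BigOperators Pointwise
open Literature.Probability.LatticeModels Literature.Probability.Percolation
open Literature.Probability.LatticeModels.MedialTrail
open Literature.Probability.RandomPlanarGeometry (DobrushinDomain)
open Summit.CriticalPhenomena.CardyFormulaZ2.Theses.CardyComplexCone

noncomputable section

/-- The coded point of a corner is within one mesh of its vertex (plane picture `psiC`). -/
theorem dist_psiC_cpos_le_SR4 {δ : ℝ} (hδ : 0 ≤ δ) (p : Site 2 × Fin 4) :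
    dist (psiC δ (cpos p)) (meshPoint δ p.1) ≤ δ := by
  rw [← medialPoint_cSrc_eq_psiC_SR]
  exact dist_medialPoint_cSrc_le' hδ p

/-- **Slipped return, ball-exit pair: the certificate** (registered `ufrs_slippedReturn_ballExit_certJ`,
the (R1) half of the residual `ufrs_slippedReturnCase_certJ`). DATA: the hypotheses of
`ufrs_slippedReturnCase_certJ` with the pair hypothesis specialised to `a = a'` and
`medialPoint E.δ (cSrc a) ∈ B(E.δ v, ρ)`. CONCLUSION: the conclusion of `ufrs_slippedReturnCase_certJ`
(we prove its first disjunct: `ω ∈ ufrsCert E w z (4η) (ρ/2)` at a collar point `z ∈ D`, namely the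
vertex of the split corner of the last bad common time; see the module docstring). -/
theorem ufrs_slippedReturn_ballExit_certJ : ∀ (D : DobrushinDomain) (η : ℝ), 0 < η → ∃ δ₀ > (0:ℝ), ∀ E : DiscreteDobrushin, E.Ω = D.carrier → E.IsZdAdmissible → E.δ < δ₀ → ∀ (v w : Site 2) (ρ : ℝ), 4 * η ≤ ρ → 2 * ρ ≤ infDist (meshPoint E.δ v) D.carrierᶜ → ‖meshPoint E.δ w‖ < η → ∀ (ω : BondConfig (Site 2)) (a a' : Site 2 × Fin 4) (n m k T : ℕ), a = a' → medialPoint E.δ (cSrc a) ∈ ball (meshPoint E.δ v) ρ → (∀ i < n, medialPoint E.δ (cTgt (cornerOrbit (E.bcBondConfig ω) a i)) ∉ ball (meshPoint E.δ v) ρ ∧ E.IsInnerFace (cFace (cornerOrbit (E.bcBondConfig ω) a (i + 1)))) → medialPoint E.δ (cTgt (cornerOrbit (E.bcBondConfig ω) a n)) ∈ ball (meshPoint E.δ v) ρ → m < n → (∀ i < k, medialPoint E.δ (cTgt (cornerOrbit ((shiftData E w).bcBondConfig ω) a' i)) ∉ ball (meshPoint E.δ v) ρ ∧ (shiftData E w).IsInnerFace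 (cFace (cornerOrbit ((shiftData E w).bcBondConfig ω) a' (i + 1)))) → cornerOrbit ((shiftData E w).bcBondConfig ω) a' k = cornerOrbit (E.bcBondConfig ω) a m → ∑ i ∈ Finset.range k, turnOf ((shiftData E w).bcBondConfig ω) (cornerOrbit ((shiftData E w).bcBondConfig ω) a' i) = ∑ i ∈ Finset.range m, turnOf (E.bcBondConfig ω) (cornerOrbit (E.bcBondConfig ω) a i) → infDist (meshPoint E.δ (cornerOrbit (E.bcBondConfig ω) a m).1) D.carrierᶜ < 3 * η → ¬ (cTgt (cornerOrbit (E.bcBondConfig ω) a m) ∈ E.bcBondConfig ω ↔ cTgt (cornerOrbit (E.bcBondConfig ω) a m) ∈ (shiftData E w).bcBondConfig ω) → (∀ j j₀ : ℕ, m < j₀ → j₀ ≤ n → (∀ i < j, medialPoint E.δ (cTgt (cornerOrbit ((shiftData E w).bcBondConfig ω) (cornerOrbit (E.bcBondConfig ω) a m) i)) ∉ ball (meshPoint E.δ v) ρ ∧ (shiftData E w).IsInnerFace (cFace (cornerOrbit ((shiftData E w).bcBondConfig ω) (cornerOrbit (E.bcBondConfig ω) a m) (i + 1)))) → cornerOrbit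 ((shiftData E w).bcBondConfig ω) (cornerOrbit (E.bcBondConfig ω) a m) j = cornerOrbit (E.bcBondConfig ω) a j₀ → ∑ i ∈ Finset.range j, turnOf ((shiftData E w).bcBondConfig ω) (cornerOrbit ((shiftData E w).bcBondConfig ω) (cornerOrbit (E.bcBondConfig ω) a m) i) ≠ ∑ i ∈ Finset.Ico m j₀, turnOf (E.bcBondConfig ω) (cornerOrbit (E.bcBondConfig ω) a i)) → (∀ i < T, medialPoint E.δ (cTgt (cornerOrbit ((shiftData E w).bcBondConfig ω) (cornerOrbit (E.bcBondConfig ω) a m) i)) ∉ ball (meshPoint E.δ v) ρ ∧ (shiftData E w).IsInnerFace (cFace (cornerOrbit ((shiftData E w).bcBondConfig ω) (cornerOrbit (E.bcBondConfig ω) a m) (i + 1)))) → (medialPoint E.δ (cTgt (cornerOrbit ((shiftData E w).bcBondConfig ω) (cornerOrbit (E.bcBondConfig ω) a m) T)) ∈ ball (meshPoint E.δ v) ρ ∨ ¬ (shiftData E w).IsInnerFace (cFace (cornerOrbit ((shiftData E w).bcBondConfig ω) (cornerOrbit (E.bcBondConfig ω) a m) (T + 1)))) → cornerOrbit ((shiftData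 E w).bcBondConfig ω) (cornerOrbit (E.bcBondConfig ω) a m) T = cornerOrbit (E.bcBondConfig ω) a n → medialPoint E.δ (cTgt (cornerOrbit ((shiftData E w).bcBondConfig ω) (cornerOrbit (E.bcBondConfig ω) a m) T)) ∈ ball (meshPoint E.δ v) ρ → ∃ z ∈ D.carrier, infDist z D.carrierᶜ < 3 * η ∧ (ω ∈ ufrsCert E w z (4 * η) (ρ / 2) ∨ (z ∈ ufrsMarkedNbhd E w (4 * η) ∧ ∃ R' : ℝ, (∃ k : ℕ, R' = ρ / 2 / 2 / 2 ^ (k + 1)) ∧ 32 * (4 * η) ≤ R' ∧ ω ∈ ufrsStrands E w z 2 (4 * η) R' ∧ ω ∈ ufrsStrands E w z 2 (4 * R') (ρ / 2 / 2))) := by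
  intro D η hη
  obtain ⟨δ₁, hδ₁, hcollar⟩ := collarAgreement D η hη
  refine ⟨min δ₁ η, lt_min hδ₁ hη, ?_⟩
  intro E hEΩ hE hEδ v w ρ hηρ hv hw ω a a' n m k T haa hA hStr hball hmn hG hek hsum hcol hdisc hmis hrun hTend
    hret hTball
  subst haa
  set β₀ := E.bcBondConfig ω with hβ₀
  set β₁ := (shiftData E w).bcBondConfig ω with hβ₁
  have hδ : 0 < E.δ := hE.delta_pos
  have hδ₁' : E.δ < δ₁ := lt_of_lt_of_le hEδ (min_le_left _ _)
  have hδη : E.δ ≤ η := (lt_of_lt_of_le hEδ (min_le_right _ _)).le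
  have hρ : 0 < ρ := by linarith
  /- 1. the two stretches -/
  have hO₁ : ∀ i, cornerOrbit β₁ a (k + i) = cornerOrbit β₁ (cornerOrbit β₀ a m) i := fun i => by
    rw [cornerOrbit_add_eq, hek]
  have hend : cornerOrbit β₀ a n = cornerOrbit β₁ a (k + T) := by rw [hO₁, hret]
  have hinj₀ : ∀ i j : ℕ, i ≤ n → j ≤ n → cornerOrbit β₀ a i = cornerOrbit β₀ a j → i = j :=
    fun i j hi hj h => cornerOrbit_injOn_stretch (I := {e | medialPoint E.δ e ∈ ball (meshPoint E.δ v) ρ})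
      (fun i hi => (hStr i hi).1) hball hi hj h
  have hout₁ : ∀ j < k + T, medialPoint E.δ (cTgt (cornerOrbit β₁ a j)) ∉ ball (meshPoint E.δ v) ρ := by
    intro j hj
    rcases Nat.lt_or_ge j k with hjk | hjk
    · exact (hG j hjk).1
    · obtain ⟨i, rfl⟩ := Nat.exists_eq_add_of_le hjk
      rw [hO₁]
      exact (hrun i (by omega)).1
  have hin₁ : medialPoint E.δ (cTgt (cornerOrbit β₁ a (k + T))) ∈ ball (meshPoint E.δ v) ρ := by
    rw [hO₁]; exact hTball
  have hinj₁ : ∀ i j : ℕ, i ≤ k + T → j ≤ k + T → cornerOrbit β₁ a i = cornerOrbit β₁ a j → i = j :=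
    fun i j hi hj h => cornerOrbit_injOn_stretch (I := {e | medialPoint E.δ e ∈ ball (meshPoint E.δ v) ρ})
      hout₁ hin₁ hi hj h
  have hturn : ∑ i ∈ Finset.range n, turnOf β₀ (cornerOrbit β₀ a i) ≠
      ∑ j ∈ Finset.range (k + T), turnOf β₁ (cornerOrbit β₁ a j) := by
    intro h
    rw [Finset.sum_range_add] at h
    simp only [hO₁] at h
    rw [hsum, ← Finset.sum_range_add_sum_Ico _ hmn.le] at h
    exact hmis T n hmn le_rfl hrun hret (by linarith)
  have hfaceE : ∀ t, 1 ≤ t → t ≤ n → E.IsInnerFace (cFace (cornerOrbit β₀ a t)) := by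
    intro t h1 ht
    obtain ⟨t', rfl⟩ : ∃ t', t = t' + 1 := ⟨t - 1, by omega⟩
    exact (hStr t' (by omega)).2
  have hface₁ : ∀ t, 1 ≤ t → t ≤ k + T → (shiftData E w).IsInnerFace (cFace (cornerOrbit β₁ a t)) := by
    intro t h1 ht
    obtain ⟨t', rfl⟩ : ∃ t', t = t' + 1 := ⟨t - 1, by omega⟩
    rcases Nat.lt_or_ge t' k with htk | htk
    · exact (hG t' htk).2
    · obtain ⟨i, rfl⟩ := Nat.exists_eq_add_of_le htk
      rw [show k + i + 1 = k + (i + 1) by ring, hO₁]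
      exact (hrun i (by omega)).2
  have hstep₀ : ∀ t, dist (meshPoint E.δ (cornerOrbit β₀ a (t + 1)).1) (meshPoint E.δ (cornerOrbit β₀ a t).1) ≤ E.δ :=
    fun t => by have := dist_meshPoint_cornerOrbit_succ_le β₀ a E.δ t; rwa [abs_of_pos hδ] at this
  have hstep₁ : ∀ t, dist (meshPoint E.δ (cornerOrbit β₁ a (t + 1)).1) (meshPoint E.δ (cornerOrbit β₁ a t).1) ≤ E.δ :=
    fun t => by have := dist_meshPoint_cornerOrbit_succ_le β₁ a E.δ t; rwa [abs_of_pos hδ] at this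
  have hn1 : 1 ≤ n := by omega
  have hN1 : 1 ≤ k + T := by
    rcases Nat.eq_zero_or_pos (k + T) with h0 | h
    · exfalso
      rw [h0] at hend
      have := hinj₀ n 0 le_rfl (Nat.zero_le _) hend
      omega
    · exact h
  /- 2. the winding weights at a face next to the first dart -/
  have hts : ∑ i ∈ Finset.range n, turnSign β₀ (cornerOrbit β₀ a i) ≠ ∑ j ∈ Finset.range (k + T), turnSign β₁ (cornerOrbit β₁ a j) := by
    intro h
    apply hturn
    simp only [turnOf_eq, ← Finset.mul_sum]
    congr 1
    exact_mod_cast congrArg (fun z : ℤ => (z : ℝ)) h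
  set pa : ℤ := 2 * (v 0 + v 1) - 1 with hpa
  set pb : ℤ := 2 * (v 1 - v 0) + 1 with hpb
  have hao : pa % 2 = 1 := by omega
  have hbo : pb % 2 = 1 := by omega
  have hA' : psiC E.δ (cpos a) ∈ ball (meshPoint E.δ v) ρ := by rwa [medialPoint_cSrc_eq_psiC_SR] at hA
  have hB' : psiC E.δ (cpos (cornerOrbit β₀ a (n + 1))) ∈ ball (meshPoint E.δ v) ρ := by
    rw [← medialPoint_cTgt_cornerOrbit_SR]; exact hball
  have hfarpot : ∀ (β : BondConfig (Site 2)) (N : ℕ), (∀ i < N, medialPoint E.δ (cTgt (cornerOrbit β a i)) ∉ ball (meshPoint E.δ v) ρ) →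
      ∀ i, 1 ≤ i → i ≤ N → max ((2 * (cpos a).1 - pa) ^ 2 + (2 * (cpos a).2 - pb) ^ 2)
        ((2 * (cpos (cornerOrbit β₀ a (n + 1))).1 - pa) ^ 2 + (2 * (cpos (cornerOrbit β₀ a (n + 1))).2 - pb) ^ 2) <
        (2 * (cpos (cornerOrbit β a i)).1 - pa) ^ 2 + (2 * (cpos (cornerOrbit β a i)).2 - pb) ^ 2 := by
    intro β N hout i hi hiN
    have hQ := hout (i - 1) (by omega)
    rw [medialPoint_cTgt_cornerOrbit_SR, show i - 1 + 1 = i by omega] at hQ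
    exact max_lt (pot_lt_of_ball_SR hδ hA' hQ) (pot_lt_of_ball_SR hδ hB' hQ)
  obtain ⟨F, hF, hneF⟩ := twoArc_dartWnd_ne_SR β₀ β₁ a n (k + T) pa pb hao hbo hn1 hN1 hinj₀ hinj₁ hend
    (hfarpot β₀ n fun i hi => (hStr i hi).1) (hfarpot β₁ (k + T) hout₁) hts
  have hadj : (F.1 = (cpos a).1 ∨ F.1 = (cpos a).1 - 1) ∧ (F.2 = (cpos a).2 ∨ F.2 = (cpos a).2 - 1) := by
    rcases hF with rfl | rfl
    · exact (faces_adjacent_tail_SR _).1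
    · exact (faces_adjacent_tail_SR _).2
  set P₀ : ℕ → Pt := fun i => cpos (cornerOrbit β₀ a i) with hP₀
  set P₁ : ℕ → Pt := fun j => cpos (cornerOrbit β₁ a j) with hP₁
  set wa : ℕ → ℤ := fun i => dartWnd (P₀ i, P₀ (i + 1)) F with hwa
  set wb : ℕ → ℤ := fun j => dartWnd (P₁ j, P₁ (j + 1)) F with hwb
  have hcom : ∀ i j, cornerOrbit β₁ a j = cornerOrbit β₀ a i → P₁ j = P₀ i ∧ P₁ (j + 1) = P₀ (i + 1) := by
    intro i j h
    refine ⟨congrArg cpos h, ?_⟩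
    change cpos (nextCorner β₁ (cornerOrbit β₁ a j)) = cpos (nextCorner β₀ (cornerOrbit β₀ a i))
    rw [cpos_nextCorner, cpos_nextCorner, h]
  have hu₀ : ∀ i, IsUnitStep (P₀ i) (P₀ (i + 1)) := fun i => (isDart_cpos β₀ (cornerOrbit β₀ a i)).isUnitStep
  have hu₁ : ∀ j, IsUnitStep (P₁ j) (P₁ (j + 1)) := fun j => (isDart_cpos β₁ (cornerOrbit β₁ a j)).isUnitStep
  /- 3. the last bad common time `s`, `O₁ a s = O₀ a σ` -/
  obtain ⟨s, σ, hsN, hσn, hsσ, hoff, hlater⟩ :=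
    exists_lastBad_common_SR (cornerOrbit β₀ a) (cornerOrbit β₁ a) n (k + T) wa wb rfl hneF
  have hab : wb s = wa σ := by
    simp only [hwa, hwb]; rw [(hcom σ s hsσ).1, (hcom σ s hsσ).2]
  have hsN' : s < k + T := by
    refine lt_of_le_of_ne hsN fun h => hoff ?_
    have hσ : σ = n := hinj₀ σ n hσn le_rfl (hsσ.symm.trans (h ▸ hend.symm))
    rw [h, hσ]
  have hσn' : σ < n := by
    refine lt_of_le_of_ne hσn fun h => ?_
    have : s = k + T := hinj₁ s (k + T) hsN le_rfl (hsσ.trans (h ▸ hend))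
    omega
  -- the two dynamics split at `O₀ a σ`
  have hsplit : cornerOrbit β₁ a (s + 1) ≠ cornerOrbit β₀ a (σ + 1) := by
    intro h
    have := hlater (s + 1) (σ + 1) (Nat.lt_succ_self _) (by omega) (by omega) h
    apply hoff
    rw [Finset.sum_range_succ, Finset.sum_range_succ] at this
    linarith
  have hst : ¬ (cTgt (cornerOrbit β₀ a σ) ∈ β₀ ↔ cTgt (cornerOrbit β₀ a σ) ∈ β₁) := by
    intro hiff
    apply hsplit
    change nextCorner β₁ (cornerOrbit β₁ a s) = nextCorner β₀ (cornerOrbit β₀ a σ)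
    rw [hsσ]
    by_cases hm : cTgt (cornerOrbit β₀ a σ) ∈ β₀
    · rw [nextCorner_of_mem hm, nextCorner_of_mem (hiff.1 hm)]
    · rw [nextCorner_of_not_mem hm, nextCorner_of_not_mem (fun h => hm (hiff.2 h))]
  /- 4. the collar point `z` -/
  set z : ℂ := meshPoint E.δ (cornerOrbit β₀ a σ).1 with hz
  have hcolX : infDist z D.carrierᶜ < 3 * η := by
    by_contra hdeep
    rw [not_lt] at hdeep
    have hagree := hcollar E hEΩ hE hδ₁' w hw ω (cornerOrbit β₀ a σ).1 hdeep
    have := (no_discrepancy_of_agree hδ.le hagree (cornerOrbit β₀ a σ).2 β₀).1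
    rw [Prod.mk.eta] at this
    exact hst this
  have hfar0 : ρ - 3 * η - E.δ < dist (meshPoint E.δ a.1) z :=
    far_of_cSrc_mem_ball (E := E) (Ω := D.carrier) hδ.le hv hcolX hA
  have hfarn : ρ - 3 * η - E.δ < dist (meshPoint E.δ (cornerOrbit β₀ a n).1) z :=
    far_of_cTgt_mem_ball (E := E) (Ω := D.carrier) hδ.le hv hcolX hball
  have hfarN : ρ - 3 * η - E.δ < dist (meshPoint E.δ (cornerOrbit β₁ a (k + T)).1) z := by
    rw [← hend]; exact hfarn
  have hfar1 : ρ - 3 * η - 2 * E.δ < dist (meshPoint E.δ (cornerOrbit β₀ a 1).1) z := by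
    have h1 := hstep₀ 0
    have h2 := dist_triangle (meshPoint E.δ a.1) (meshPoint E.δ (cornerOrbit β₀ a 1).1) z
    change dist (meshPoint E.δ (cornerOrbit β₀ a 1).1) (meshPoint E.δ a.1) ≤ E.δ at h1
    rw [dist_comm] at h1
    linarith
  have hσ1 : 1 ≤ σ := by
    rcases Nat.eq_zero_or_pos σ with h0 | h
    · exfalso
      have : dist (meshPoint E.δ a.1) z = 0 := by
        rw [hz, h0]; exact dist_self _
      linarith
    · exact h
  have hzD : z ∈ D.carrier := by
    rw [← hEΩ]
    exact meshPoint_mem_of_isCorner_of_isInnerFace (isCorner_cFace _) (hfaceE σ hσ1 hσn)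
  refine ⟨z, hzD, hcolX, Or.inl ?_⟩
  by_cases hesc : ρ / 2 < 256 * (4 * η)
  · exact mem_ufrsCert_of_lt_W3H hesc
  rw [not_lt] at hesc
  /- 5. the windows around `σ` and the exit time `g` -/
  have hσ2 : 1 < σ := by
    by_contra h
    have h1 : σ = 1 := by omega
    have : dist (meshPoint E.δ (cornerOrbit β₀ a 1).1) z = 0 := by
      rw [hz, ← h1]; exact dist_self _
    linarith
  obtain ⟨h', hh'1, hh'σ, hh'far, hh'max⟩ : ∃ h', 1 ≤ h' ∧ h' < σ ∧
      ρ / 4 + 4 * E.δ ≤ dist (meshPoint E.δ (cornerOrbit β₀ a h').1) z ∧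
      ∀ i, h' < i → i < σ → dist (meshPoint E.δ (cornerOrbit β₀ a i).1) z < ρ / 4 + 4 * E.δ := by
    classical
    set W : ℕ → Prop := fun i => ρ / 4 + 4 * E.δ ≤ dist (meshPoint E.δ (cornerOrbit β₀ a i).1) z with hW
    have hW1 : W 1 := by simp only [hW]; linarith
    refine ⟨Nat.findGreatest W (σ - 1), Nat.le_findGreatest (by omega) hW1, ?_,
      Nat.findGreatest_spec (P := W) (by omega : 1 ≤ σ - 1) hW1, fun i hi hiσ => ?_⟩
    · have := Nat.findGreatest_le (P := W) (σ - 1); omega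
    · have := Nat.findGreatest_is_greatest (P := W) hi (by omega : i ≤ σ - 1)
      simp only [hW, not_le] at this
      exact this
  obtain ⟨i', hi'σ, hi'n, hi'far, hi'min⟩ : ∃ i', σ < i' ∧ i' ≤ n ∧
      ρ / 4 + 4 * E.δ ≤ dist (meshPoint E.δ (cornerOrbit β₀ a i').1) z ∧
      ∀ i, σ < i → i < i' → dist (meshPoint E.δ (cornerOrbit β₀ a i).1) z < ρ / 4 + 4 * E.δ := by
    classical
    have hex : ∃ i, σ < i ∧ i ≤ n ∧ ρ / 4 + 4 * E.δ ≤ dist (meshPoint E.δ (cornerOrbit β₀ a i).1) z :=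
      ⟨n, hσn', le_rfl, by linarith⟩
    refine ⟨Nat.find hex, (Nat.find_spec hex).1, (Nat.find_spec hex).2.1, (Nat.find_spec hex).2.2,
      fun i hi hii => ?_⟩
    have := Nat.find_min hex hii
    push Not at this
    exact this hi (by have := (Nat.find_spec hex).2.1; omega)
  obtain ⟨g, hgs, hgN, hgfar, hgmin⟩ : ∃ g, s < g ∧ g ≤ k + T ∧
      ρ / 4 + 2 * E.δ ≤ dist (meshPoint E.δ (cornerOrbit β₁ a g).1) z ∧
      ∀ j, s < j → j < g → dist (meshPoint E.δ (cornerOrbit β₁ a j).1) z < ρ / 4 + 2 * E.δ := by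
    classical
    have hex : ∃ j, s < j ∧ j ≤ k + T ∧ ρ / 4 + 2 * E.δ ≤ dist (meshPoint E.δ (cornerOrbit β₁ a j).1) z :=
      ⟨k + T, hsN', le_rfl, by linarith⟩
    refine ⟨Nat.find hex, (Nat.find_spec hex).1, (Nat.find_spec hex).2.1, (Nat.find_spec hex).2.2,
      fun j hj hjg => ?_⟩
    have := Nat.find_min hex hjg
    push Not at this
    exact this hj (by have := (Nat.find_spec hex).2.1; omega)
  -- the first step after the split stays next to `z`
  have hnear₁ : dist (meshPoint E.δ (cornerOrbit β₁ a (s + 1)).1) z ≤ E.δ := by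
    have := hstep₁ s; rwa [hsσ] at this
  have hnear₀ : dist (meshPoint E.δ (cornerOrbit β₀ a (σ + 1)).1) z ≤ E.δ := hstep₀ σ
  have hgs2 : s + 2 ≤ g := by
    by_contra h
    have hg : g = s + 1 := by omega
    rw [hg] at hgfar
    linarith
  /- 6. the key disjointness: the second stretch after the split avoids the window -/
  have hfcA : ‖faceCentreC E.δ F - psiC E.δ (cpos a)‖ ≤ E.δ := norm_faceCentre_sub_le_SR hδ F (cpos a) hadj
  have hAz : ρ - 3 * η < dist (psiC E.δ (cpos a)) z := by
    have h1 := infDist_le_infDist_add_dist (x := meshPoint E.δ v) (y := psiC E.δ (cpos a)) (s := D.carrierᶜ)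
    have h2 := infDist_le_infDist_add_dist (x := psiC E.δ (cpos a)) (y := z) (s := D.carrierᶜ)
    rw [mem_ball, dist_comm] at hA'
    linarith
  have hFz : 2 * (ρ / 4 + 5 * E.δ) ≤ dist (faceCentreC E.δ F) z := by
    have h1 := dist_triangle (psiC E.δ (cpos a)) (faceCentreC E.δ F) z
    have h3 : dist (psiC E.δ (cpos a)) (faceCentreC E.δ F) ≤ E.δ := by
      rw [dist_comm, dist_eq_norm]; exact hfcA
    linarith
  have hkey : ∀ j, s < j → j ≤ g → ∀ i, h' ≤ i → i ≤ i' → cornerOrbit β₁ a j ≠ cornerOrbit β₀ a i := by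
    intro j hj hjg i hi hii heq
    rcases eq_or_ne i σ with rfl | hiσ
    · have := hinj₁ j s (by omega) hsN (heq.trans hsσ.symm); omega
    by_cases hfi : ρ / 4 + 4 * E.δ ≤ dist (meshPoint E.δ (cornerOrbit β₀ a i).1) z
    · -- a far corner of the window: `j = g`, and then `g - 1` is already far
      have hjfar : ρ / 4 + 2 * E.δ ≤ dist (meshPoint E.δ (cornerOrbit β₁ a j).1) z := by rw [heq]; linarith
      have hjg' : j = g := by
        by_contra hne
        have := hgmin j hj (lt_of_le_of_ne hjg hne)
        linarith
      subst hjg'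
      have h1 := hstep₁ (j - 1)
      rw [show j - 1 + 1 = j by omega, heq] at h1
      have h2 := dist_triangle (meshPoint E.δ (cornerOrbit β₀ a i).1) (meshPoint E.δ (cornerOrbit β₁ a (j - 1)).1) z
      have := hgmin (j - 1) (by omega) (by omega)
      linarith
    · -- a near corner other than `O₀ a σ`: a later common time, against confinement
      rw [not_le] at hfi
      have hih' : h' < i := lt_of_le_of_ne hi (by rintro rfl; linarith)
      have hii' : i < i' := lt_of_le_of_ne hii (by rintro rfl; linarith)
      have hcommon := hlater j i hj (by omega) (by omega) heq
      have hR : ∀ i₀, dist (meshPoint E.δ (cornerOrbit β₀ a i₀).1) z < ρ / 4 + 4 * E.δ →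
          dist (psiC E.δ (P₀ i₀)) z < ρ / 4 + 5 * E.δ := by
        intro i₀ hi₀
        have h1 := dist_psiC_cpos_le_SR4 hδ.le (cornerOrbit β₀ a i₀)
        have h2 := dist_triangle (psiC E.δ (P₀ i₀)) (meshPoint E.δ (cornerOrbit β₀ a i₀).1) z
        simp only [hP₀] at h2 ⊢
        linarith
      have hwin : ∀ i₀, h' < i₀ → i₀ < i' → dist (meshPoint E.δ (cornerOrbit β₀ a i₀).1) z < ρ / 4 + 4 * E.δ := by
        intro i₀ h1 h2
        rcases lt_trichotomy i₀ σ with hlt | rfl | hgt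
        · exact hh'max i₀ h1 hlt
        · rw [hz, dist_self]; positivity
        · exact hi'min i₀ hgt h2
      have hc₀ : ∀ i₀, σ ≤ i₀ → i₀ ≤ i → dist (psiC E.δ (P₀ i₀)) z < ρ / 4 + 5 * E.δ :=
        fun i₀ h1 h2 => hR i₀ (hwin i₀ (by omega) (by omega))
      have hc₀' : ∀ i₀, i ≤ i₀ → i₀ ≤ σ → dist (psiC E.δ (P₀ i₀)) z < ρ / 4 + 5 * E.δ :=
        fun i₀ h1 h2 => hR i₀ (hwin i₀ (by omega) (by omega))
      have hc₁ : ∀ j₀, s < j₀ → j₀ ≤ j → dist (psiC E.δ (P₁ j₀)) z < ρ / 4 + 5 * E.δ := by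
        intro j₀ h1 h2
        rcases lt_or_eq_of_le h2 with hlt | rfl
        · have h3 := hgmin j₀ h1 (by omega)
          have h4 := dist_psiC_cpos_le_SR4 hδ.le (cornerOrbit β₁ a j₀)
          have h5 := dist_triangle (psiC E.δ (P₁ j₀)) (meshPoint E.δ (cornerOrbit β₁ a j₀).1) z
          simp only [hP₁] at h5 ⊢
          linarith
        · rw [(hcom i j₀ heq).1]
          exact hR i hfi
      have hconf := twoArc_offset_eq_of_confined_SR P₀ P₁ F E.δ z (ρ / 4 + 5 * E.δ) s j σ i hδ hu₀ hu₁ hj.le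
        (hcom σ s hsσ).1 (hcom i j heq).1 hc₀ hc₀' hc₁ hFz
      apply hoff
      change ∑ m ∈ Finset.range i, wa m - ∑ m ∈ Finset.range σ, wa m =
        ∑ m ∈ Finset.range j, wb m - ∑ m ∈ Finset.range s, wb m at hconf
      linarith
  /- 7. three long strands at `z` -/
  have hρ4 : ρ / 2 / 2 = ρ / 4 := by ring
  have h₁ : h' ≤ σ ∧ ((dist (meshPoint E.δ (cornerOrbit β₀ a h').1) z ≤ (4 * η) ∧ (ρ / 2 / 2) ≤ dist (meshPoint E.δ (cornerOrbit β₀ a σ).1) z) ∨ ((ρ / 2 / 2) ≤ dist (meshPoint E.δ (cornerOrbit β₀ a h').1) z ∧ dist (meshPoint E.δ (cornerOrbit β₀ a σ).1) z ≤ (4 * η))) ∧ (∀ t, h' ≤ t → t ≤ σ → E.IsInnerFace (cFace (cornerOrbit β₀ a t))) ∧ (∀ s t, h' ≤ s → s < t → t ≤ σ → cornerOrbit β₀ a s ≠ cornerOrbit β₀ a t) := by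
    refine ⟨hh'σ.le, Or.inr ⟨by linarith, ?_⟩, fun t ht htσ => hfaceE t (by omega) (by omega),
      stretch_ne_of_lt_W3H hinj₀ hσn⟩
    rw [hz, dist_self]; positivity
  have h₂ : σ + 1 ≤ i' ∧ ((dist (meshPoint E.δ (cornerOrbit β₀ a (σ + 1)).1) z ≤ (4 * η) ∧ (ρ / 2 / 2) ≤ dist (meshPoint E.δ (cornerOrbit β₀ a i').1) z) ∨ ((ρ / 2 / 2) ≤ dist (meshPoint E.δ (cornerOrbit β₀ a (σ + 1)).1) z ∧ dist (meshPoint E.δ (cornerOrbit β₀ a i').1) z ≤ (4 * η))) ∧ (∀ t, σ + 1 ≤ t → t ≤ i' → E.IsInnerFace (cFace (cornerOrbit β₀ a t))) ∧ (∀ s t, σ + 1 ≤ s → s < t → t ≤ i' → cornerOrbit β₀ a s ≠ cornerOrbit β₀ a t) :=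
    ⟨by omega, Or.inl ⟨by linarith, by linarith⟩, fun t ht hti => hfaceE t (by omega) (by omega),
      stretch_ne_of_lt_W3H hinj₀ hi'n⟩
  have h₃ : s + 1 ≤ g ∧ ((dist (meshPoint E.δ (cornerOrbit β₁ a (s + 1)).1) z ≤ (4 * η) ∧ (ρ / 2 / 2) ≤ dist (meshPoint E.δ (cornerOrbit β₁ a g).1) z) ∨ ((ρ / 2 / 2) ≤ dist (meshPoint E.δ (cornerOrbit β₁ a (s + 1)).1) z ∧ dist (meshPoint E.δ (cornerOrbit β₁ a g).1) z ≤ (4 * η))) ∧ (∀ t, s + 1 ≤ t → t ≤ g → (shiftData E w).IsInnerFace (cFace (cornerOrbit β₁ a t))) ∧ (∀ s' t, s + 1 ≤ s' → s' < t → t ≤ g → cornerOrbit β₁ a s' ≠ cornerOrbit β₁ a t) :=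
    ⟨by omega, Or.inl ⟨by linarith, by linarith⟩, fun t ht htg => hface₁ t (by omega) (by omega),
      stretch_ne_of_lt_W3H hinj₁ hgN⟩
  have h₁₂ : ∀ s t, h' ≤ s → s ≤ σ → σ + 1 ≤ t → t ≤ i' → cornerOrbit β₀ a s ≠ cornerOrbit β₀ a t := by
    intro s' t _ hs' ht hti h
    have := hinj₀ s' t (by omega) (by omega) h
    omega
  have h₁₃ : ∀ s' t, h' ≤ s' → s' ≤ σ → s + 1 ≤ t → t ≤ g → cornerOrbit β₀ a s' ≠ cornerOrbit β₁ a t :=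
    fun s' t hs' hs'σ ht htg h => hkey t (by omega) htg s' hs' (by omega) h.symm
  have h₂₃ : ∀ s' t, σ + 1 ≤ s' → s' ≤ i' → s + 1 ≤ t → t ≤ g → cornerOrbit β₀ a s' ≠ cornerOrbit β₁ a t :=
    fun s' t hs' hs'i ht htg h => hkey t (by omega) htg s' (by omega) hs'i h.symm
  exact mem_ufrsCert_of_three_far_W3H true true false a a a h' σ (σ + 1) i' (s + 1) g hη hesc h₁ h₂ h₃ h₁₂ h₁₃ h₂₃

end

end Summit.CriticalPhenomena.CardyFormulaZ2.Cruxes.EdgePrecompact.QkzStripBoundaryArm
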